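import Summits.FinalStateConjecture.FinalStateConjecture.Statement
import Literature.Geometry.Lorentzian.CauchyDevelopmentPrecomp
import Summits.FinalStateConjecture.FinalStateConjecture.Theorems.PhotonSphereChannelsTameCensorshipTameOuterPrecompIff

/-!
# The K3 property of one datum is GAUGE INVARIANT (registered stub `stub_qK3ComapIff`, line `Sketch` =
unwind-the-threshold-from-scri, crux `PhotonSphereChannels.TameCensorship`, item stmt-FinalStateConjecture-17431)

`Q(D)` := "an MGHD of `D` exists, and every MGHD of `D` has (a) complete `𝓘⁺`, (i) no extremal late
chart, (ii) `C³`-bounded outer geometry at a uniform scale" — verbatim the lambda of the crux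
`TameCensorship` — holds for the re-indexed datum `Φ^* D = D.comap Φ` iff it holds for `D`, for every
diffeomorphism `Φ` of the data manifold (a homeomorphism, smooth with injective differentials, inverse
likewise). Proof: MGHD existence and any re-indexing-invariant property of developments transfer along
`VacuumCauchyDevelopment.precomp` (`exists_isMaximal_comap_iff`, `forall_isMaximal_comap_iff`,
`CauchyDevelopmentPrecomp.lean`); clause (a) is `hasCompleteFutureNullInfinity_precomp_iff` (tree),
clause (i) reads the spacetime only (`precomp` keeps it: `Iff.rfl`), clause (ii) is the landed
`stub_tameOuterPrecompIff`. Consequences recorded by the line: the exceptional set of K3 is a union of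
gauge orbits, so the tree's tame SELF-WITNESS curves (`InitialDataSet.exists_tame_selfWitness`,
breathing curves = isometric copies) never witness K3 at an exceptional datum (Disproof.lean cycle 4,
"recorded as prose" — now a theorem), and conversely a K3-good datum stays good along them (the
line's gauge shear). Lead prover-line-stmt-FinalStateConjecture-17431-0, 2026-08-17.
-/

-- summit-side namespace repeats a component by design (summit = problem)
set_option linter.dupNamespace false

open Literature.Geometry.Lorentzian
open scoped Manifold ContDiff Topology
open Filter Set Function

namespace Summit.FinalStateConjecture.FinalStateConjecture.Theorems.PhotonSphereChannels.TameCensorshipUnwind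

/-- **The K3 property is invariant under re-indexing the datum by a diffeomorphism of `Σ`.** For
`Φ : X ≃ₜ X` smooth with injective differentials and inverse likewise: `Q(Φ^* D) ↔ Q(D)`, where `Q` is
verbatim the property of the crux `TameCensorship` (∃MGHD ∧ ∀MGHD (a) ∧ (i) ∧ (ii)). -/
theorem stub_qK3ComapIff :
    ∀ (X : Type) [TopologicalSpace X] [ChartedSpace E3 X] [IsManifold (𝓡 3) ∞ X] [T2Space X]
      [SecondCountableTopology X] [ConnectedSpace X]
      (D : InitialDataSet (𝓡 3) X) (Φ : X ≃ₜ X) (hΦ : ContMDiff (𝓡 3) (𝓡 3) (∞ + 1) Φ)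
      (hΦ' : ∀ u, Injective (mfderiv (𝓡 3) (𝓡 3) Φ u)),
      ContMDiff (𝓡 3) (𝓡 3) (∞ + 1) Φ.symm → (∀ u, Injective (mfderiv (𝓡 3) (𝓡 3) Φ.symm u)) →
      (((∃ 𝒟 : VacuumCauchyDevelopment (D.comap Φ hΦ hΦ'), 𝒟.IsMaximal) ∧
          ∀ 𝒟 : VacuumCauchyDevelopment (D.comap Φ hΦ hΦ'), 𝒟.IsMaximal →
            HasCompleteNullInfinity 𝒟.toCauchyDevelopment ∧
            ((∀ (Λ : lorentzGroup) (c : E4) (M a : ℝ), Kerr.IsExtremal M a →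
                ¬ ∃ (τ₀ : ℝ) (Ψ : (boostedKerrBackground Λ c M a).domain → 𝒟.carrier),
                  𝒟.toSpacetime.IsLateChart (boostedKerrBackground Λ c M a) Set.univ τ₀ Ψ ∧
                    ∀ R : ℝ, Tendsto (fun τ => 𝒟.toSpacetime.truncDeviationCk
                      (boostedKerrBackground Λ c M a) Ψ 2 R τ) atTop (nhds 0)) ∧
              ∀ [𝒟.metric.HasLeviCivita],
                let outer : Set 𝒟.carrier :=
                  𝒟.metric.causalFuture 𝒟.timeOrientation (Set.range 𝒟.embed) ∩
                    {q | ∃ (p : X) (γ : ℝ → 𝒟.carrier) (dom : Set ℝ),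
                      𝒟.metric.IsNormalisedNullRayFrom 𝒟.timeOrientation 𝒟.embed 𝒟.normal p γ dom ∧
                        ¬ BddAbove dom ∧
                          q ∈ 𝒟.metric.chronologicalPast 𝒟.timeOrientation (γ '' (dom ∩ Set.Ici 0))}
                ∃ r₀ : ℝ, 0 < r₀ ∧ ∃ Λ : NNReal, ∀ q ∈ outer,
                  let U : TopologicalSpace.Opens E4 := ⟨Metric.ball (0 : E4) r₀, Metric.isOpen_ball⟩
                  ∃ Ψ : U → 𝒟.carrier,
                    𝒟.toSpacetime.IsLateChart (Minkowski.backgroundOn U) Set.univ (-r₀) Ψ ∧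
                      (∃ x : U, (x : E4) = 0 ∧ Ψ x = q) ∧
                        supCkENorm (U : Set E4) 3
                            (𝒟.toSpacetime.deviationExtend (Minkowski.backgroundOn U) Ψ) ≤ (Λ : ENNReal) ∧
                          supCkENorm (U : Set E4) 0
                            (𝒟.toSpacetime.deviationExtend (Minkowski.backgroundOn U) Ψ) ≤ 1 / 2)) ↔
        ((∃ 𝒟 : VacuumCauchyDevelopment D, 𝒟.IsMaximal) ∧
          ∀ 𝒟 : VacuumCauchyDevelopment D, 𝒟.IsMaximal →
            HasCompleteNullInfinity 𝒟.toCauchyDevelopment ∧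
            ((∀ (Λ : lorentzGroup) (c : E4) (M a : ℝ), Kerr.IsExtremal M a →
                ¬ ∃ (τ₀ : ℝ) (Ψ : (boostedKerrBackground Λ c M a).domain → 𝒟.carrier),
                  𝒟.toSpacetime.IsLateChart (boostedKerrBackground Λ c M a) Set.univ τ₀ Ψ ∧
                    ∀ R : ℝ, Tendsto (fun τ => 𝒟.toSpacetime.truncDeviationCk
                      (boostedKerrBackground Λ c M a) Ψ 2 R τ) atTop (nhds 0)) ∧
              ∀ [𝒟.metric.HasLeviCivita],
                let outer : Set 𝒟.carrier :=
                  𝒟.metric.causalFuture 𝒟.timeOrientation (Set.range 𝒟.embed) ∩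
                    {q | ∃ (p : X) (γ : ℝ → 𝒟.carrier) (dom : Set ℝ),
                      𝒟.metric.IsNormalisedNullRayFrom 𝒟.timeOrientation 𝒟.embed 𝒟.normal p γ dom ∧
                        ¬ BddAbove dom ∧
                          q ∈ 𝒟.metric.chronologicalPast 𝒟.timeOrientation (γ '' (dom ∩ Set.Ici 0))}
                ∃ r₀ : ℝ, 0 < r₀ ∧ ∃ Λ : NNReal, ∀ q ∈ outer,
                  let U : TopologicalSpace.Opens E4 := ⟨Metric.ball (0 : E4) r₀, Metric.isOpen_ball⟩
                  ∃ Ψ : U → 𝒟.carrier,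
                    𝒟.toSpacetime.IsLateChart (Minkowski.backgroundOn U) Set.univ (-r₀) Ψ ∧
                      (∃ x : U, (x : E4) = 0 ∧ Ψ x = q) ∧
                        supCkENorm (U : Set E4) 3
                            (𝒟.toSpacetime.deviationExtend (Minkowski.backgroundOn U) Ψ) ≤ (Λ : ENNReal) ∧
                          supCkENorm (U : Set E4) 0
                            (𝒟.toSpacetime.deviationExtend (Minkowski.backgroundOn U) Ψ) ≤ 1 / 2))) := by
  intro X _ _ _ _ _ _ D Φ hΦ hΦ' hΨ hΨ'
  refine and_congr (VacuumCauchyDevelopment.exists_isMaximal_comap_iff Φ hΦ hΦ' hΨ hΨ') ?_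
  refine VacuumCauchyDevelopment.forall_isMaximal_comap_iff Φ hΦ hΦ' hΨ hΨ'
    (fun {D'} 𝒟 => HasCompleteNullInfinity 𝒟.toCauchyDevelopment ∧
      ((∀ (Λ : lorentzGroup) (c : E4) (M a : ℝ), Kerr.IsExtremal M a →
          ¬ ∃ (τ₀ : ℝ) (Ψ : (boostedKerrBackground Λ c M a).domain → 𝒟.carrier),
            𝒟.toSpacetime.IsLateChart (boostedKerrBackground Λ c M a) Set.univ τ₀ Ψ ∧
              ∀ R : ℝ, Tendsto (fun τ => 𝒟.toSpacetime.truncDeviationCk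
                (boostedKerrBackground Λ c M a) Ψ 2 R τ) atTop (nhds 0)) ∧
        ∀ [𝒟.metric.HasLeviCivita],
          let outer : Set 𝒟.carrier :=
            𝒟.metric.causalFuture 𝒟.timeOrientation (Set.range 𝒟.embed) ∩
              {q | ∃ (p : X) (γ : ℝ → 𝒟.carrier) (dom : Set ℝ),
                𝒟.metric.IsNormalisedNullRayFrom 𝒟.timeOrientation 𝒟.embed 𝒟.normal p γ dom ∧
                  ¬ BddAbove dom ∧
                    q ∈ 𝒟.metric.chronologicalPast 𝒟.timeOrientation (γ '' (dom ∩ Set.Ici 0))}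
          ∃ r₀ : ℝ, 0 < r₀ ∧ ∃ Λ : NNReal, ∀ q ∈ outer,
            let U : TopologicalSpace.Opens E4 := ⟨Metric.ball (0 : E4) r₀, Metric.isOpen_ball⟩
            ∃ Ψ : U → 𝒟.carrier,
              𝒟.toSpacetime.IsLateChart (Minkowski.backgroundOn U) Set.univ (-r₀) Ψ ∧
                (∃ x : U, (x : E4) = 0 ∧ Ψ x = q) ∧
                  supCkENorm (U : Set E4) 3
                      (𝒟.toSpacetime.deviationExtend (Minkowski.backgroundOn U) Ψ) ≤ (Λ : ENNReal) ∧
                    supCkENorm (U : Set E4) 0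
                      (𝒟.toSpacetime.deviationExtend (Minkowski.backgroundOn U) Ψ) ≤ 1 / 2))
    fun 𝒟 Θ hΘ hΘ' => ?_
  refine and_congr (𝒟.hasCompleteFutureNullInfinity_precomp_iff Θ hΘ hΘ') (and_congr Iff.rfl ?_)
  exact stub_tameOuterPrecompIff X _ 𝒟.toCauchyDevelopment Θ

end Summit.FinalStateConjecture.FinalStateConjecture.Theorems.PhotonSphereChannels.TameCensorshipUnwind
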